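import Summits.QuantumFields.YangMills.Theorems.BalabanUVNodesN15CurvedGluingCubeDressedGeneral
import Summits.QuantumFields.YangMills.Theorems.BalabanUVNodesN15TwoSpacingGluingNonlocal
import HarnessLib

/-!
# Route «BalabanUVNodes» (cluster K4 «SpineRates»), Track-A DAG node N15 = NE2, BACKGROUND LAYER — THE COMMUTATOR OF THE DRESSED PERTURBATION WITH THE PARTITION: `[𝒱, M_h]∘X` for an arbitrary
# decaying perturbation `V̂` of the jet (`𝒱 = V̂∘jet`), its letter (FILE 56's nonlocal commutator + the jet's Leibniz remainder), input-localized — the `𝒱`-half of FILE 45∕55's remainder row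
# `[Δ, M_h]∘G_□` when the cube is dressed at a live background

Cell `pub-ymgap`, seat `pub-ymgap-dag-n15-w3` (WIDTH SEAT 3∕3 on node N15, director-ym №197 ∕ HUMAN RULING D-0149; plan `W-SEAT-START-LIST.md` §n15 item 3 — twenty-sixth piece).
`bears_on: R4∕N15 · K3⁷ SpineGivenEndpointR13SepCoPH (stmt-QuantumFields-20544)`.  Filed `--kind proof --supports stmt-QuantumFields-20544 --as helper` — COUNT-NEUTRAL.  Theorems only;
0 `sorry`.  Imports BY NAME file 23 `…N15CurvedGluingCubeDressedGeneral` (`dressedV_eq_jet_comp`, `dressedV_comp_eq_self`; file 21 `mulOp_eq_zero_of_vanish`; file 20 `hasMaj_localize_out`;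
dag-n15-c B2 `stack`∕`projO`∕`hasMaj_projO_comp`∕`hasMaj_stack`, FILE 45 `commOp`∕`hasMaj_comp_diag`) and dag-n15-c FILE 56 `…N15TwoSpacingGluingNonlocal` (`hasMaj_comm_nonlocal`); lit
`hasMaj_comp_exp`; nothing in the tree is modified.

WHY.  FILE 45's remainder row is `[Δ_a, M_{h_□}]∘G_□`.  With `Δ_a = Δ_flat − 𝒱` (the cube dressed by `𝒱 = V̂∘jet`, file 23) it splits as `[Δ_flat, M_h]∘X − [𝒱, M_h]∘X`; the first is
FILE 46∕52's Leibniz row on `X`'s entries (+ FILE 56 for the flat nonlocal `W`), the second is NEW at a live background: the jet's Leibniz identity `jet∘M_h = M_a∘jet + D_h`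
(`a` = `h` read on the jet's components, e.g. `h`, `h∘e_μ`, `h∘e_μ⁻¹`; `D_h` = the zero-order remainder `(0, (M_{∇^±_μh})_μ)`) gives EXACTLY
`[𝒱, M_h]∘X = (V̂∘M_a − M_h∘V̂)∘X̂ + V̂∘D_h∘X` (`X̂ = jet∘X`), and FILE 56's two-carrier nonlocal commutator letter (block-Lipschitz `ℓ`, oscillation `ω` of the partition, both `O(M⁻¹)`)
plus `|∇^±h| ≤ c₁` bound it by `((ℓ(eε)⁻¹ + 2ω)R·A·c_r + R·c₁·A·c_r)·e^{−ρ₃d}` — small twice (the perturbation's `R` AND the partition's `O(M⁻¹)`).  As [B5] p. 38 warns for nonlocal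
operators, the row is only INPUT-localized (FILE 57's one-sided remainder rows consume exactly that).

* §1 `jet_comp_mulOp` (the quotient jet's Leibniz identity, exact), ★★ `commOp_dressedPert_comp_eq` (`[𝒱, M_h]∘X = (V̂M_a − M_hV̂)∘X̂ + V̂∘D_h∘X` for ANY jet with a Leibniz identity);
* §2 `hasMaj_localize_in`, ★★ `hasMaj_commOp_dressedPert_comp` (the letter), ★★ `hasMaj_commOp_dressedPert_comp_in` (input-localized `1_S(y′)` from `G₀ = G₀M_ψ`).

HONEST FRAMING ∕ LIMITS.  Finite-dimensional algebra + block-majorant bookkeeping over DISPLAYED letters (the perturbation's decay `R, δ_V` — for `P₁(A)` this is (3.77) — the partition's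
`ℓ, ω, c₁`, the pair's majorant `A`); nothing of [B5]∕[B6]∕[B9] asserted ((1.120)–(1.128) pp. 37–38, (2.91)–(2.92) p. 239, (3.62)–(3.65), (3.76)–(3.77) = SHAPES ∕ MECHANISM).  NE2⁺ NOT
PRINTED, NOT proved; N15 NOT discharged; counts of record UNMOVED (typed 28∕28 · discharged 5∕27); one finite 𝕋⁴ at fixed ε — NOT infinite volume, NOT OS on ℝ⁴, NOT a mass gap, NOT Clay; R4
closes the conditional finite-𝕋⁴ rung `BalabanLadder.UV` only.  Restate-immune (no Theses import).
-/

set_option autoImplicit false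

noncomputable section
open scoped BigOperators
open Finset

namespace Summit.QuantumFields.YangMills.BalabanUVNodes.N15.CurvedSpecies

open Literature.MathematicalPhysics.QuantumFieldTheory.Balaban1983to89
open Literature.MathematicalPhysics.QuantumFieldTheory.Balaban1983to89.B11SectG (BlockNorm HasMaj RowSum hasMaj_comp_exp)
open Literature.MathematicalPhysics.QuantumFieldTheory.Balaban1983to89.B6RandomWalk (Triangle254)
open Literature.MathematicalPhysics.QuantumFieldTheory.Balaban1983to89.T4EtaRateCoeffDefect (diagK diagK_nonneg)
open Literature.MathematicalPhysics.QuantumFieldTheory.Balaban1983to89.B6Prop26Gluing (mulOp mulOp_apply ind ind_nonneg ind_of_mem)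
open Summit.QuantumFields.YangMills.BalabanUVNodes.N15.MatrixSpecies (liftBlk liftEquiv liftEquiv_apply liftEquiv_symm_apply)
open Summit.QuantumFields.YangMills.BalabanUVNodes.N15.BackgroundModel (kappa_ofBlocks)
open Summit.QuantumFields.YangMills.BalabanUVNodes.N15.BackgroundLayer (fgrad bgrad fgrad_apply bgrad_apply stack projO blkPair hasMaj_stack hasMaj_projO_comp bgPropV)
open Summit.QuantumFields.YangMills.BalabanUVNodes.N15.Gluing (commOp loc_ofBlocks_eq_zero hasMaj_comp_diag hasMaj_comm_nonlocal)

/-! ## §1 The jet's Leibniz identity and the exact split of `[𝒱, M_h]∘X` -/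

section Algebra

variable {X ι J : Type} [Fintype X] [DecidableEq X] [Fintype ι] [DecidableEq ι] [Fintype J] [DecidableEq J] (τ : J → X ≃ X) (n : ℝ)

omit [Fintype X] [DecidableEq X] [Fintype ι] [DecidableEq ι] [Fintype J] [DecidableEq J] in
/-- **THE QUOTIENT JET's LEIBNIZ IDENTITY**: `jet∘M_h = M_a∘jet + D_h` with `a(p, none) = h(p)`, `a(p, +μ) = h(e_μp)`, `a(p, −μ) = h(e_μ⁻¹p)` and `D_h = (0, (M_{∇⁺_μh})_μ, (M_{∇⁻_μh})_μ)`: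
`∇⁺(hf) = (h∘e)·∇⁺f + (∇⁺h)·f`, `∇⁻(hf) = (h∘e⁻¹)·∇⁻f + (∇⁻h)·f`. [cite: Balaban1984PropagatorsII, p.239 («Using the formulas (1.126)–(1.128)»: mechanism)] -/
theorem jet_comp_mulOp (h : X × ι → ℝ) :
    stack LinearMap.id (fun j : J ⊕ J => Sum.elim (fun μ => fgrad n (liftEquiv (τ μ) ι)) (fun μ => bgrad n (liftEquiv (τ μ) ι)) j) ∘ₗ mulOp h =
      mulOp (fun q : (X × ι) × Option (J ⊕ J) => Option.elim q.2 (h q.1)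
          (fun j => Sum.elim (fun μ => h (liftEquiv (τ μ) ι q.1)) (fun μ => h ((liftEquiv (τ μ) ι).symm q.1)) j)) ∘ₗ
        stack LinearMap.id (fun j : J ⊕ J => Sum.elim (fun μ => fgrad n (liftEquiv (τ μ) ι)) (fun μ => bgrad n (liftEquiv (τ μ) ι)) j) +
      stack 0 (fun j : J ⊕ J => Sum.elim (fun μ => mulOp (fgrad n (liftEquiv (τ μ) ι) h)) (fun μ => mulOp (bgrad n (liftEquiv (τ μ) ι) h)) j) := by
  refine LinearMap.ext fun f => funext fun q => ?_
  rcases q with ⟨p, _ | j⟩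
  · simp only [LinearMap.comp_apply, LinearMap.add_apply, Pi.add_apply, BackgroundLayer.stack_apply_none, LinearMap.id_apply, mulOp_apply, Option.elim,
      LinearMap.zero_apply, Pi.zero_apply, add_zero]
  · rcases j with μ | μ
    · simp only [LinearMap.comp_apply, LinearMap.add_apply, Pi.add_apply, BackgroundLayer.stack_apply_some, Sum.elim_inl, mulOp_apply, Option.elim, fgrad_apply]
      ring
    · simp only [LinearMap.comp_apply, LinearMap.add_apply, Pi.add_apply, BackgroundLayer.stack_apply_some, Sum.elim_inr, mulOp_apply, Option.elim, bgrad_apply]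
      ring

variable {Y K : Type} [Fintype Y] [Fintype K] [DecidableEq Y] [DecidableEq K] {G₀ : (Y → ℝ) →ₗ[ℝ] (Y → ℝ)} {D Dq : K → (Y → ℝ) →ₗ[ℝ] (Y → ℝ)}
  {V : (Y × Option K → ℝ) →ₗ[ℝ] (Y → ℝ)}

/-- ★★ **THE EXACT SPLIT**: for a jet with a Leibniz identity `jet∘M_h = M_a∘jet + D_h`, `[𝒱, M_h]∘X = (V̂∘M_a − M_h∘V̂)∘X̂ + V̂∘D_h∘X` (`𝒱 = V̂∘jet`, `X = pr₀X̂`, `X̂ = jet∘X`).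
[cite: Balaban1984PropagatorsII, (2.91)–(2.92) p.239 (the remainder's commutator: mechanism); Balaban1985BackgroundPropagators, (3.62)–(3.65) pp.402–403] -/
theorem commOp_dressedPert_comp_eq {h : Y → ℝ} {a : Y × Option K → ℝ} {Dh : (Y → ℝ) →ₗ[ℝ] (Y × Option K → ℝ)}
    (hjet : stack LinearMap.id Dq ∘ₗ mulOp h = mulOp a ∘ₗ stack LinearMap.id Dq + Dh) (hD : ∀ j, D j = Dq j ∘ₗ G₀) (hunit : IsUnit (1 - LinearMap.toMatrix' (stack G₀ D ∘ₗ V))) :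
    commOp (V ∘ₗ stack LinearMap.id Dq) h ∘ₗ (projO none ∘ₗ bgPropV (stack G₀ D) V) =
      (V ∘ₗ mulOp a - mulOp h ∘ₗ V) ∘ₗ bgPropV (stack G₀ D) V + V ∘ₗ Dh ∘ₗ (projO none ∘ₗ bgPropV (stack G₀ D) V) := by
  have hX := dressedV_eq_jet_comp (V := V) hD hunit
  have h1 : stack LinearMap.id Dq ∘ₗ mulOp h ∘ₗ (projO none ∘ₗ bgPropV (stack G₀ D) V) =
      mulOp a ∘ₗ bgPropV (stack G₀ D) V + Dh ∘ₗ (projO none ∘ₗ bgPropV (stack G₀ D) V) := by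
    rw [← LinearMap.comp_assoc, hjet, LinearMap.add_comp, LinearMap.comp_assoc, ← hX]
  have hA : ((V ∘ₗ stack LinearMap.id Dq) ∘ₗ mulOp h) ∘ₗ (projO none ∘ₗ bgPropV (stack G₀ D) V) =
      V ∘ₗ (mulOp a ∘ₗ bgPropV (stack G₀ D) V) + V ∘ₗ (Dh ∘ₗ (projO none ∘ₗ bgPropV (stack G₀ D) V)) := by
    rw [LinearMap.comp_assoc, LinearMap.comp_assoc, h1, LinearMap.comp_add]
  have hB : (mulOp h ∘ₗ (V ∘ₗ stack LinearMap.id Dq)) ∘ₗ (projO none ∘ₗ bgPropV (stack G₀ D) V) = mulOp h ∘ₗ (V ∘ₗ bgPropV (stack G₀ D) V) := by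
    rw [LinearMap.comp_assoc, LinearMap.comp_assoc, ← hX]
  rw [commOp, LinearMap.sub_comp, hA, hB]
  simp only [LinearMap.sub_comp, LinearMap.comp_assoc]
  abel

end Algebra

/-! ## §2 The letter, and its input localization -/

section Letter

variable {X ι J : Type} [Fintype X] [DecidableEq X] [Fintype ι] [DecidableEq ι] [Fintype J] [DecidableEq J] {g : B6.Geometry} (blk : X → g.Site) {σ cr : ℝ}
  {G₀ : (X × ι → ℝ) →ₗ[ℝ] (X × ι → ℝ)} {D Dq : J ⊕ J → (X × ι → ℝ) →ₗ[ℝ] (X × ι → ℝ)} {V : ((X × ι) × Option (J ⊕ J) → ℝ) →ₗ[ℝ] (X × ι → ℝ)}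

omit [DecidableEq X] [DecidableEq ι] [Fintype J] [DecidableEq J] in
/-- ONE-SIDED (INPUT) LOCALIZATION: an operator reading its input only over `S` has its majorant `K ≥ 0` improved to `1_S(y′)·K`. [cite: Balaban1984PropagatorsII, (2.133) p.247 («y′ ∈ 𝔅 ∩ T_□»: shape)] -/
theorem hasMaj_localize_in {F : Type} [AddCommGroup F] [Module ℝ F] {b₂ : BlockNorm g F} {R : (X × ι → ℝ) →ₗ[ℝ] F} {S : Set g.Site} {K : g.Site → g.Site → ℝ}
    (hK : ∀ a b, 0 ≤ K a b) (hin : ∀ μ : X × ι → ℝ, (∀ p, liftBlk blk ι p ∈ S → μ p = 0) → R μ = 0) (hR : HasMaj (BlockNorm.ofBlocks g (liftBlk blk ι)) b₂ R K) :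
    HasMaj (BlockNorm.ofBlocks g (liftBlk blk ι)) b₂ R (fun y y' => ind S y' * K y y') := by
  intro y' μ hμ y
  dsimp only
  have hμ' : ∀ p, liftBlk blk ι p ≠ y' → μ p = 0 := hμ
  by_cases hy' : y' ∈ S
  · rw [ind_of_mem hy', one_mul]
    exact hR y' μ hμ y
  · have hR0 : R μ = 0 := hin μ fun p hp => hμ' p fun h => hy' (h ▸ hp)
    rw [hR0, b₂.loc_zero]
    exact mul_nonneg (mul_nonneg (ind_nonneg _ _) (hK _ _)) ((BlockNorm.ofBlocks g (liftBlk blk ι)).loc_nonneg y' μ)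

/-- ★★ **THE LETTER OF `[𝒱, M_h]∘X`**: `V̂ ≤ Re^{−δ_Vd}` (pair → base), the partition `h` and its jet reading `a` within `ω` of a block-constant `hb` with block-Lipschitz constant `ℓ`, `ε > 0`,
the Leibniz remainder `D_h ≤ diagK c₁`, the pair `X̂ ≤ Ae^{−ρ₂d}`; rates `ρ₃ ≤ ρ₂`, `ρ₃ + σ ≤ δ_V − ε` ⟹
`[𝒱, M_h]∘X ≤ ((ℓ(eε)⁻¹ + 2ω)R·A·c_r + R·c₁·A·c_r)·e^{−ρ₃d}`. [cite: Balaban1984PropagatorsI, (1.120)–(1.128) pp.37–38 (nonlocal commutator: mechanism); Balaban1984PropagatorsII, (2.133)–(2.134) p.247 (shape)] -/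
theorem hasMaj_commOp_dressedPert_comp (htri : Triangle254 g) (hd : ∀ a b : g.Site, 0 ≤ g.dist a b) (hsymm : ∀ y y', g.dist y y' = g.dist y' y) (hrow : RowSum g σ cr)
    {ρ₂ ρ₃ δV ε R A ℓ ω c₁ : ℝ} (hR : 0 ≤ R) (hA : 0 ≤ A) (hℓ : 0 ≤ ℓ) (hω : 0 ≤ ω) (hε : 0 < ε) (hc₁ : 0 ≤ c₁) (hρ₃ : 0 ≤ ρ₃) (hρ₃₂ : ρ₃ ≤ ρ₂) (hρ₃V : ρ₃ + σ ≤ δV - ε)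
    {h : X × ι → ℝ} {a : (X × ι) × Option (J ⊕ J) → ℝ} {Dh : (X × ι → ℝ) →ₗ[ℝ] ((X × ι) × Option (J ⊕ J) → ℝ)} {hb : g.Site → ℝ}
    (hjet : stack LinearMap.id Dq ∘ₗ mulOp h = mulOp a ∘ₗ stack LinearMap.id Dq + Dh) (hD : ∀ j, D j = Dq j ∘ₗ G₀) (hunit : IsUnit (1 - LinearMap.toMatrix' (stack G₀ D ∘ₗ V)))
    (hLip : ∀ y y', |hb y - hb y'| ≤ ℓ * g.dist y y') (hra : ∀ q, |a q - hb (blkPair (liftBlk blk ι) q)| ≤ ω) (hrh : ∀ p, |h p - hb (liftBlk blk ι p)| ≤ ω)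
    (hV : HasMaj (BlockNorm.ofBlocks g (blkPair (liftBlk blk ι))) (BlockNorm.ofBlocks g (liftBlk blk ι)) V (fun y y' => R * Real.exp (-(δV * g.dist y y'))))
    (hDh : HasMaj (BlockNorm.ofBlocks g (liftBlk blk ι)) (BlockNorm.ofBlocks g (blkPair (liftBlk blk ι))) Dh (diagK fun _ => c₁))
    (hX : HasMaj (BlockNorm.ofBlocks g (liftBlk blk ι)) (BlockNorm.ofBlocks g (blkPair (liftBlk blk ι))) (bgPropV (stack G₀ D) V) (fun y y' => A * Real.exp (-(ρ₂ * g.dist y y')))) :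
    HasMaj (BlockNorm.ofBlocks g (liftBlk blk ι)) (BlockNorm.ofBlocks g (liftBlk blk ι)) (commOp (V ∘ₗ stack LinearMap.id Dq) h ∘ₗ (projO none ∘ₗ bgPropV (stack G₀ D) V))
      (fun y y' => ((ℓ * (Real.exp 1 * ε)⁻¹ + 2 * ω) * R * A * cr + R * c₁ * A * cr) * Real.exp (-(ρ₃ * g.dist y y'))) := by
  rw [commOp_dressedPert_comp_eq hjet hD hunit]
  -- the twisted commutator of `V̂` (FILE 56, two carriers), then through `X̂`
  have hC := hasMaj_comm_nonlocal (blkPair (liftBlk blk ι)) (liftBlk blk ι) hR hℓ hω hε hd hsymm hLip hra hrh hV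
  have hL0 : 0 ≤ (ℓ * (Real.exp 1 * ε)⁻¹ + 2 * ω) * R := by positivity
  have t1 := hasMaj_comp_exp htri hd hrow hL0 hA hρ₃ hρ₃₂ hρ₃V hC hX
  -- the Leibniz remainder: `V̂∘D_h ≤ Rc₁e^{−δ_Vd}`, then through `X = pr₀X̂`
  have hVD : HasMaj (BlockNorm.ofBlocks g (liftBlk blk ι)) (BlockNorm.ofBlocks g (liftBlk blk ι)) (V ∘ₗ Dh) (fun y y' => R * c₁ * Real.exp (-(δV * g.dist y y'))) := by
    refine (hasMaj_comp_diag (blkPair (liftBlk blk ι)) (fun _ _ => mul_nonneg hR (Real.exp_nonneg _)) hV hDh).mono fun y y' => le_of_eq ?_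
    ring
  have hX0 := hasMaj_projO_comp (liftBlk blk ι) hX none
  have hρ₃V' : ρ₃ + σ ≤ δV := by linarith
  have t2 := hasMaj_comp_exp htri hd hrow (mul_nonneg hR hc₁) hA hρ₃ hρ₃₂ hρ₃V' hVD hX0
  have t2' : HasMaj (BlockNorm.ofBlocks g (liftBlk blk ι)) (BlockNorm.ofBlocks g (liftBlk blk ι)) (V ∘ₗ Dh ∘ₗ (projO none ∘ₗ bgPropV (stack G₀ D) V))
      (fun y y' => (BlockNorm.ofBlocks g (liftBlk blk ι)).κ * (R * c₁) * A * cr * Real.exp (-(ρ₃ * g.dist y y'))) := by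
    rw [← LinearMap.comp_assoc]; exact t2
  refine (t1.add t2').mono fun y y' => le_of_eq ?_
  rw [kappa_ofBlocks, kappa_ofBlocks]; ring

/-- ★★ **… INPUT-LOCALIZED** (the only localization a nonlocal `𝒱` allows — FILE 57's one-sided remainder rows): with the flat cube's input cut-off `G₀ = G₀M_ψ` over `S`,
`[𝒱, M_h]∘X ≤ 1_S(y′)·(…)e^{−ρ₃d}`. [cite: Balaban1984PropagatorsI, p.38 («except the term P(dh)»); Balaban1984PropagatorsII, (2.133) p.247 (shape)] -/
theorem hasMaj_commOp_dressedPert_comp_in (htri : Triangle254 g) (hd : ∀ a b : g.Site, 0 ≤ g.dist a b) (hsymm : ∀ y y', g.dist y y' = g.dist y' y) (hrow : RowSum g σ cr)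
    {ρ₂ ρ₃ δV ε R A ℓ ω c₁ : ℝ} (hR : 0 ≤ R) (hA : 0 ≤ A) (hℓ : 0 ≤ ℓ) (hω : 0 ≤ ω) (hε : 0 < ε) (hc₁ : 0 ≤ c₁) (hcr : 0 ≤ cr) (hρ₃ : 0 ≤ ρ₃) (hρ₃₂ : ρ₃ ≤ ρ₂)
    (hρ₃V : ρ₃ + σ ≤ δV - ε) {h : X × ι → ℝ} {a : (X × ι) × Option (J ⊕ J) → ℝ} {Dh : (X × ι → ℝ) →ₗ[ℝ] ((X × ι) × Option (J ⊕ J) → ℝ)} {hb : g.Site → ℝ}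
    (hjet : stack LinearMap.id Dq ∘ₗ mulOp h = mulOp a ∘ₗ stack LinearMap.id Dq + Dh) (hD : ∀ j, D j = Dq j ∘ₗ G₀) (hunit : IsUnit (1 - LinearMap.toMatrix' (stack G₀ D ∘ₗ V)))
    {S : Set g.Site} {ψX : X → ℝ} (hSψ : ∀ x, ψX x ≠ 0 → blk x ∈ S) (hGψ : G₀ ∘ₗ mulOp (fun p : X × ι => ψX p.1) = G₀)
    (hLip : ∀ y y', |hb y - hb y'| ≤ ℓ * g.dist y y') (hra : ∀ q, |a q - hb (blkPair (liftBlk blk ι) q)| ≤ ω) (hrh : ∀ p, |h p - hb (liftBlk blk ι p)| ≤ ω)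
    (hV : HasMaj (BlockNorm.ofBlocks g (blkPair (liftBlk blk ι))) (BlockNorm.ofBlocks g (liftBlk blk ι)) V (fun y y' => R * Real.exp (-(δV * g.dist y y'))))
    (hDh : HasMaj (BlockNorm.ofBlocks g (liftBlk blk ι)) (BlockNorm.ofBlocks g (blkPair (liftBlk blk ι))) Dh (diagK fun _ => c₁))
    (hX : HasMaj (BlockNorm.ofBlocks g (liftBlk blk ι)) (BlockNorm.ofBlocks g (blkPair (liftBlk blk ι))) (bgPropV (stack G₀ D) V) (fun y y' => A * Real.exp (-(ρ₂ * g.dist y y')))) :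
    HasMaj (BlockNorm.ofBlocks g (liftBlk blk ι)) (BlockNorm.ofBlocks g (liftBlk blk ι)) (commOp (V ∘ₗ stack LinearMap.id Dq) h ∘ₗ (projO none ∘ₗ bgPropV (stack G₀ D) V))
      (fun y y' => ind S y' * (((ℓ * (Real.exp 1 * ε)⁻¹ + 2 * ω) * R * A * cr + R * c₁ * A * cr) * Real.exp (-(ρ₃ * g.dist y y')))) := by
  have key := hasMaj_commOp_dressedPert_comp blk htri hd hsymm hrow hR hA hℓ hω hε hc₁ hρ₃ hρ₃₂ hρ₃V hjet hD hunit hLip hra hrh hV hDh hX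
  have hinp : (projO none ∘ₗ bgPropV (stack G₀ D) V) ∘ₗ mulOp (fun p : X × ι => ψX p.1) = projO none ∘ₗ bgPropV (stack G₀ D) V := by
    rw [LinearMap.comp_assoc, dressedV_comp_eq_self (V := V) hD hGψ]
  refine hasMaj_localize_in blk (fun y y' => mul_nonneg (by positivity) (Real.exp_nonneg _)) (fun μ hμ => ?_) key
  rw [LinearMap.comp_apply, ← hinp, LinearMap.comp_apply, mulOp_eq_zero_of_vanish blk hSψ μ hμ, map_zero, map_zero]

end Letter

end Summit.QuantumFields.YangMills.BalabanUVNodes.N15.CurvedSpecies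

end
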